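import Literature.Probability.LatticeModels.PlanarIsingMultiPointCovariance
import Literature.Probability.LatticeModels.PlanarIsingMeshTranslate
import Literature.Analysis.Asymptotics.StepRatioRiemannSum
import Literature.Topology.Euclidean.PlanarStaircase
import HarnessLib

/-!
# CHI Proposition 2.20 (ratio limits of spin correlations) from CHI Theorem 1.5 — lattice part

Topic `Literature/Probability/LatticeModels`, namespace `Literature.Probability.LatticeModels`.
Chelkak–Hongler–Izyurov, Ann. of Math. 181 (2015) = arXiv:1202.2838 (CHI), §2.8: Proposition 2.20
(`𝔼⁺_{Ω_δ}[σ_{b_0}⋯σ_{b_k}] / 𝔼⁺_{Ω_δ}[σ_{a_0}⋯σ_{a_k}]` converges, to the exponential of a line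
integral of the form `ℒ_{Ω,k+1} = ∑_j Re[𝒜_Ω(a_j; …) da_j]`) is "a straightforward corollary of
Theorem 1.5 obtained via integration with respect to positions of points": along a lattice path
`v_0, …, v_N` approximating a segment, `log(𝔼[σ_{v_{j+1}}⋯]/𝔼[σ_{v_j}⋯]) = 2δ·[Re 𝒜_Ω(v_j;…) + o(1)]`
uniformly in `j` (Thm 1.5), and the sum is a Riemann sum; adjacent faces of different colours are
compared by Remark 2.18.

This file sets up the hypothesis predicates — in the tree's coordinates (sites `δℤ²` = CHI's faces,
so that CHI's same-colour steps `a ↦ a + 2δ_CHI`, `a ↦ a + 2iδ_CHI` are the *diagonal* steps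
`a ↦ a + δ(±1 ± i)` and CHI's adjacent faces are axis neighbours) — and proves the lattice
preliminaries: configuration spaces, compact-uniform freeness/injectivity of the rounded sites,
eventual positivity of the correlations on compact sets of configurations.

* `CHILogDerivative Ω 𝒜` — **CHI Thm 1.5** as a hypothesis predicate: for every compact set `K` of
  configurations of distinct points of `Ω`, every coordinate `j`, every diagonal step `u`,
  `(𝔼⁺_{Ω_δ}[σ_{a + δu e_j}]/𝔼⁺_{Ω_δ}[σ_a] - 1)/δ → Re(𝒜_j(a) u)` uniformly on `K`;
* `CHINeighbourRatio Ω` — **CHI Remark 2.18**: for axis steps `e`, `𝔼⁺[σ_{a + δe e_j}]/𝔼⁺[σ_a] → 1`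
  uniformly on compact sets of configurations.

## References

* D. Chelkak, C. Hongler, K. Izyurov, Ann. of Math. 181 (2015), Thm. 1.5, Remark 2.18, §2.8
  (Prop. 2.20 and its proof) [ChelkakHonglerIzyurovAnnals2015].
-/

noncomputable section

open Filter Topology Set Metric Complex MeasureTheory intervalIntegral
open Literature.Probability.LatticeModels

namespace Literature.Probability.LatticeModels

/-! ### Configurations of distinct marked points -/

/-- The configuration space `Ω̃^{n+1}` of `(n+1)`-tuples of distinct points of `Ω` (CHI §2.8).
[cite: ChelkakHonglerIzyurovAnnals2015, §2.8] -/
def confSet (Ω : Set ℂ) (n : ℕ) : Set (Fin (n + 1) → ℂ) :=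
  {a | Function.Injective a ∧ ∀ i, a i ∈ Ω}

/-- Membership in the configuration space. [cite: ChelkakHonglerIzyurovAnnals2015, §2.8] -/
theorem mem_confSet {Ω : Set ℂ} {n : ℕ} {a : Fin (n + 1) → ℂ} :
    a ∈ confSet Ω n ↔ Function.Injective a ∧ ∀ i, a i ∈ Ω := Iff.rfl

/-- The configuration space of an open set is open. [cite: ChelkakHonglerIzyurovAnnals2015, §2.8] -/
theorem isOpen_confSet {Ω : Set ℂ} (hΩ : IsOpen Ω) (n : ℕ) : IsOpen (confSet Ω n) := by
  have h1 : IsOpen {a : Fin (n + 1) → ℂ | Function.Injective a} := by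
    have : {a : Fin (n + 1) → ℂ | Function.Injective a} = ⋂ i, ⋂ j, {a | i ≠ j → a i ≠ a j} := by
      ext a
      simp only [mem_setOf_eq, mem_iInter]
      exact ⟨fun h i j hij hij' => hij (h hij'), fun h i j hij => by_contra fun hne => h i j hne hij⟩
    rw [this]
    refine isOpen_iInter_of_finite fun i => isOpen_iInter_of_finite fun j => ?_
    by_cases hij : i = j
    · simp [hij]
    · simp only [ne_eq, hij, not_false_eq_true, forall_const]
      exact isOpen_ne_fun (continuous_apply i) (continuous_apply j)
  have h2 : IsOpen {a : Fin (n + 1) → ℂ | ∀ i, a i ∈ Ω} := by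
    have : {a : Fin (n + 1) → ℂ | ∀ i, a i ∈ Ω} = ⋂ i, (fun a => a i) ⁻¹' Ω := by
      ext a; simp
    rw [this]
    exact isOpen_iInter_of_finite fun i => hΩ.preimage (continuous_apply i)
  exact h1.inter h2

/-- The coordinates of a compact set of configurations form a compact subset of `Ω`. [folklore] -/
theorem isCompact_coords {n : ℕ} {K : Set (Fin (n + 1) → ℂ)} (hK : IsCompact K) :
    IsCompact (⋃ i : Fin (n + 1), (fun a : Fin (n + 1) → ℂ => a i) '' K) :=
  isCompact_iUnion fun i => hK.image (continuous_apply i)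

/-- **Compact-uniform freeness of the rounded sites**: for a compact set `K` of configurations in
`Ω` and `Ω_δ` approximating `Ω`, eventually every coordinate of every configuration of `K` rounds to
a free site of `Ω_δ`. [cite: ChelkakHonglerIzyurovAnnals2015, §2.8 (uniformity on compact sets)] -/
theorem eventually_forall_mem_nearestSite_mem {Ω : Set ℂ} (hM : MeshApproximates Ω) {n : ℕ}
    {K : Set (Fin (n + 1) → ℂ)} (hK : IsCompact K) (hKΩ : K ⊆ confSet Ω n) :
    ∀ᶠ δ in 𝓝[>] (0 : ℝ), ∀ a ∈ K, ∀ i, nearestSite δ (a i) ∈ meshInteriorFinset Ω δ := by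
  have hC := isCompact_coords hK
  have hCΩ : (⋃ i : Fin (n + 1), (fun a : Fin (n + 1) → ℂ => a i) '' K) ⊆ Ω := by
    intro z hz
    simp only [mem_iUnion, mem_image] at hz
    obtain ⟨i, a, ha, rfl⟩ := hz
    exact (hKΩ ha).2 i
  filter_upwards [hM.2.2 _ hC hCΩ, self_mem_nhdsWithin] with δ hδ hδ0
  intro a ha i
  have hz : a i ∈ meshInteriorPolygon Ω δ := hδ (mem_iUnion.2 ⟨i, a, ha, rfl⟩)
  exact Finset.mem_coe.1 (mem_of_mem_meshPolygon hδ0 hz (mem_meshCell_nearestSite hδ0 (a i)))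

/-- **Uniform separation** of the points of the configurations of a compact `K ⊆ Ω̃^{n+1}`.
[folklore] -/
theorem exists_pos_forall_le_norm_sub {Ω : Set ℂ} {n : ℕ} {K : Set (Fin (n + 1) → ℂ)}
    (hK : IsCompact K) (hKΩ : K ⊆ confSet Ω n) :
    ∃ η : ℝ, 0 < η ∧ ∀ a ∈ K, ∀ i j, i ≠ j → η ≤ ‖a i - a j‖ := by
  classical
  rcases K.eq_empty_or_nonempty with rfl | hne
  · exact ⟨1, one_pos, fun a ha => ha.elim⟩
  -- the continuous function `min_{i ≠ j} |a i - a j|`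
  set P : Finset (Fin (n + 1) × Fin (n + 1)) := Finset.univ.filter fun p => p.1 ≠ p.2 with hP
  by_cases hPne : P.Nonempty
  · set F : (Fin (n + 1) → ℂ) → ℝ := fun a => P.inf' hPne fun p => ‖a p.1 - a p.2‖ with hF
    have hFc : Continuous F :=
      Continuous.finset_inf'_apply hPne fun p _ =>
        ((continuous_apply p.1).sub (continuous_apply p.2)).norm
    obtain ⟨a₀, ha₀, hmin⟩ := hK.exists_isMinOn hne hFc.continuousOn
    refine ⟨F a₀, ?_, fun a ha i j hij => ?_⟩
    · obtain ⟨p, hp, hpeq⟩ := Finset.exists_mem_eq_inf' hPne fun p => ‖a₀ p.1 - a₀ p.2‖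
      show 0 < P.inf' hPne fun p => ‖a₀ p.1 - a₀ p.2‖
      rw [hpeq]
      have hp' : p.1 ≠ p.2 := (Finset.mem_filter.1 hp).2
      exact norm_pos_iff.2 (sub_ne_zero.2 fun h => hp' ((hKΩ ha₀).1 h))
    · have h1 : F a₀ ≤ F a := hmin ha
      have h2 : F a ≤ ‖a i - a j‖ :=
        Finset.inf'_le _ (Finset.mem_filter.2 ⟨Finset.mem_univ (i, j), hij⟩)
      exact h1.trans h2
  · refine ⟨1, one_pos, fun a _ i j hij => ?_⟩
    exact absurd ⟨(i, j), Finset.mem_filter.2 ⟨Finset.mem_univ _, hij⟩⟩ hPne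

/-- **Compact-uniform injectivity of the rounded sites**: eventually the coordinates of every
configuration of a compact `K ⊆ Ω̃^{n+1}` round to distinct sites. [folklore] -/
theorem eventually_forall_nearestSite_injective {Ω : Set ℂ} {n : ℕ} {K : Set (Fin (n + 1) → ℂ)}
    (hK : IsCompact K) (hKΩ : K ⊆ confSet Ω n) :
    ∀ᶠ δ in 𝓝[>] (0 : ℝ), ∀ a ∈ K, Function.Injective fun i => nearestSite δ (a i) := by
  obtain ⟨η, hη, hsep⟩ := exists_pos_forall_le_norm_sub hK hKΩ
  have hsmall : ∀ᶠ δ in 𝓝[>] (0 : ℝ), δ < η / 2 :=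
    (nhdsWithin_le_nhds (s := Ioi (0 : ℝ))) (gt_mem_nhds (by positivity : (0 : ℝ) < η / 2))
  filter_upwards [hsmall, self_mem_nhdsWithin] with δ hδ hδ0
  intro a ha i j hij
  by_contra hne
  have h1 := dist_meshPoint_nearestSite_le (show (0 : ℝ) < δ from hδ0) (a i)
  have h2 := dist_meshPoint_nearestSite_le (show (0 : ℝ) < δ from hδ0) (a j)
  have hij' : nearestSite δ (a i) = nearestSite δ (a j) := hij
  rw [hij'] at h1
  have h3 : ‖a i - a j‖ ≤ 2 * δ := by
    rw [← dist_eq_norm]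
    calc dist (a i) (a j) ≤ dist (a i) (meshPoint δ (nearestSite δ (a j))) +
        dist (meshPoint δ (nearestSite δ (a j))) (a j) := dist_triangle _ _ _
      _ ≤ δ + δ := add_le_add (by rw [dist_comm]; exact h1) h2
      _ = 2 * δ := by ring
  have h4 := hsep a ha i j hne
  linarith

/-- **Compact-uniform GKS I**: eventually `0 ≤ 𝔼⁺_{Ω_δ}[σ_a]` for every configuration of a compact
`K ⊆ Ω̃^{n+1}`. [cite: FriedliVelenik2017, Thm. 3.20, eq. (3.21)] -/
theorem eventually_forall_meshIsingPlusCorr_nonneg {Ω : Set ℂ} (hM : MeshApproximates Ω) {n : ℕ}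
    {K : Set (Fin (n + 1) → ℂ)} (hK : IsCompact K) (hKΩ : K ⊆ confSet Ω n) :
    ∀ᶠ δ in 𝓝[>] (0 : ℝ), ∀ a ∈ K, 0 ≤ meshIsingPlusCorr Ω δ a := by
  filter_upwards [eventually_forall_mem_nearestSite_mem hM hK hKΩ,
    eventually_forall_nearestSite_injective hK hKΩ] with δ h1 h2
  exact fun a ha => meshIsingPlusCorr_nonneg (h1 a ha) (h2 a ha)

/-! ### The steps of the square lattice -/

/-- The four diagonal steps `±1 ± i` of the square lattice (CHI's same-colour moves `±2δ`, `±2iδ`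
of the face lattice, in the tree's coordinates). [cite: ChelkakHonglerIzyurovAnnals2015, Thm. 1.5] -/
def diagSteps : Set ℂ := {1 + I, 1 - I, -1 + I, -1 - I}

/-- The four axis steps `±1, ±i` of the square lattice (CHI's adjacent faces).
[cite: ChelkakHonglerIzyurovAnnals2015, Remark 2.18] -/
def axisSteps : Set ℂ := {1, -1, I, -I}

/-- Diagonal steps are lattice vectors: `u = toComplex s` with `s = (±1, ±1)`. [folklore] -/
theorem exists_site_of_mem_diagSteps {u : ℂ} (hu : u ∈ diagSteps) :
    ∃ s : Site 2, Site.toComplex s = u := by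
  simp only [diagSteps, mem_insert_iff, mem_singleton_iff] at hu
  rcases hu with rfl | rfl | rfl | rfl
  · exact ⟨![1, 1], by apply Complex.ext <;> simp⟩
  · exact ⟨![1, -1], by apply Complex.ext <;> simp⟩
  · exact ⟨![-1, 1], by apply Complex.ext <;> simp⟩
  · exact ⟨![-1, -1], by apply Complex.ext <;> simp⟩

/-- Axis steps are lattice vectors. [folklore] -/
theorem exists_site_of_mem_axisSteps {u : ℂ} (hu : u ∈ axisSteps) :
    ∃ s : Site 2, Site.toComplex s = u := by
  simp only [axisSteps, mem_insert_iff, mem_singleton_iff] at hu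
  rcases hu with rfl | rfl | rfl | rfl
  · exact ⟨![1, 0], by apply Complex.ext <;> simp⟩
  · exact ⟨![-1, 0], by apply Complex.ext <;> simp⟩
  · exact ⟨![0, 1], by apply Complex.ext <;> simp⟩
  · exact ⟨![0, -1], by apply Complex.ext <;> simp⟩

/-- The norm of a diagonal step is `√2 ≤ 2`. [folklore] -/
theorem norm_le_two_of_mem_diagSteps {u : ℂ} (hu : u ∈ diagSteps) : ‖u‖ ≤ 2 := by
  have key : ∀ v : ℂ, v.re ^ 2 = 1 → v.im ^ 2 = 1 → ‖v‖ ≤ 2 := by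
    intro v h1 h2
    have : ‖v‖ ^ 2 = 2 := by
      rw [← Complex.normSq_eq_norm_sq, Complex.normSq_apply]; nlinarith
    nlinarith [norm_nonneg v]
  simp only [diagSteps, mem_insert_iff, mem_singleton_iff] at hu
  rcases hu with rfl | rfl | rfl | rfl <;> apply key <;> simp

/-- Opposite diagonal steps are diagonal steps. [folklore] -/
theorem neg_mem_diagSteps {u : ℂ} (hu : u ∈ diagSteps) : -u ∈ diagSteps := by
  simp only [diagSteps, mem_insert_iff, mem_singleton_iff] at hu ⊢
  rcases hu with rfl | rfl | rfl | rfl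
  · right; right; right; ring
  · right; right; left; ring
  · right; left; ring
  · left; ring

/-- `meshPoint δ s = δ · toComplex s`. [folklore] -/
theorem meshPoint_eq_mul (δ : ℝ) (s : Site 2) : meshPoint δ s = (δ : ℂ) * Site.toComplex s := rfl

/-! ### The hypothesis predicates: CHI Theorem 1.5 and Remark 2.18 -/

/-- **Hypothesis predicate — CHI Theorem 1.5 in `Ω`** (convergence of the discrete logarithmic
derivatives, "uniformly over all faces at distance at least `ε` from `∂Ω` and each other"), with
respect to each marked point `a_j` (CHI §2.8: "one can move other points `a_1, …, a_k` along
horizontal and vertical segments as well"), in the tree's coordinates: for every compact set `K` of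
configurations of distinct points of `Ω`, every coordinate `j`, every diagonal step `u = ±1 ± i` and
every `ε > 0`, eventually as `δ → 0⁺`,
`|(𝔼⁺_{Ω_δ}[σ at a with a_j ↦ a_j + δu] / 𝔼⁺_{Ω_δ}[σ at a] - 1)/δ - Re(𝒜_j(a) u)| ≤ ε` for all
`a ∈ K`. Here `𝒜 n j a` stands for CHI's `𝒜_Ω(a_j; a_0, …, â_j, …, a_n)` in the normalisation
`d log⟨σ…⟩ = Re[𝒜_j da_j]`. Used only as a binder (its printed proof is the convergence of the
discrete spinor observables, CHI Thm 2.16 and Lemma 2.6, not in the tree).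
[cite: ChelkakHonglerIzyurovAnnals2015, Thm. 1.5 and §2.8] -/
def CHILogDerivative (Ω : Set ℂ) (𝒜 : (n : ℕ) → Fin (n + 1) → (Fin (n + 1) → ℂ) → ℂ) : Prop :=
  ∀ (n : ℕ) (j : Fin (n + 1)) (K : Set (Fin (n + 1) → ℂ)), IsCompact K → K ⊆ confSet Ω n →
    ∀ u ∈ diagSteps, ∀ ε : ℝ, 0 < ε → ∀ᶠ δ in 𝓝[>] (0 : ℝ), ∀ a ∈ K,
      |(meshIsingPlusCorr Ω δ (Function.update a j (a j + δ * u)) / meshIsingPlusCorr Ω δ a - 1) / δ -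
        (𝒜 n j a * u).re| ≤ ε

/-- **Hypothesis predicate — CHI Remark 2.18 in `Ω`** ("the ratio of spin-spin correlations at two
adjacent spins tends to `1`, uniformly away from the boundary"): for every compact set `K` of
configurations of distinct points of `Ω`, every coordinate `j`, every axis step `e = ±1, ±i` and every
`ε > 0`, eventually `|𝔼⁺_{Ω_δ}[σ at a with a_j ↦ a_j + δe] / 𝔼⁺_{Ω_δ}[σ at a] - 1| ≤ ε` for all
`a ∈ K`. Used only as a binder (CHI derive it from the proof of Thm 2.16).
[cite: ChelkakHonglerIzyurovAnnals2015, Remark 2.18] -/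
def CHINeighbourRatio (Ω : Set ℂ) : Prop :=
  ∀ (n : ℕ) (j : Fin (n + 1)) (K : Set (Fin (n + 1) → ℂ)), IsCompact K → K ⊆ confSet Ω n →
    ∀ e ∈ axisSteps, ∀ ε : ℝ, 0 < ε → ∀ᶠ δ in 𝓝[>] (0 : ℝ), ∀ a ∈ K,
      |meshIsingPlusCorr Ω δ (Function.update a j (a j + δ * e)) / meshIsingPlusCorr Ω δ a - 1| ≤ ε

/-- **Eventual positivity on compact sets of configurations.** Under `CHINeighbourRatio Ω` (whose
ratios are total: a vanishing denominator would give the ratio `0`, at distance `1` from `1`) and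
GKS I, eventually `0 < 𝔼⁺_{Ω_δ}[σ_a]` for all configurations `a` of a compact `K ⊆ Ω̃^{n+1}` (for the
Ising model this positivity is elementary; here it is read off the hypothesis).
[cite: ChelkakHonglerIzyurovAnnals2015, Remark 2.18] -/
theorem eventually_forall_meshIsingPlusCorr_pos {Ω : Set ℂ} (hM : MeshApproximates Ω)
    (hN : CHINeighbourRatio Ω) {n : ℕ} {K : Set (Fin (n + 1) → ℂ)} (hK : IsCompact K)
    (hKΩ : K ⊆ confSet Ω n) :
    ∀ᶠ δ in 𝓝[>] (0 : ℝ), ∀ a ∈ K, 0 < meshIsingPlusCorr Ω δ a := by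
  have h1 : (1 : ℂ) ∈ axisSteps := by simp [axisSteps]
  filter_upwards [hN n 0 K hK hKΩ 1 h1 (1 / 2) (by norm_num),
    eventually_forall_meshIsingPlusCorr_nonneg hM hK hKΩ] with δ hδ hnn
  intro a ha
  rcases (hnn a ha).lt_or_eq with h | h
  · exact h
  · exfalso
    have := hδ a ha
    rw [← h, div_zero, zero_sub, abs_neg, abs_one] at this
    norm_num at this

/-- The correlation depends on the marked points only through their rounded sites. [folklore] -/
theorem meshIsingPlusCorr_congr_sites {Ω : Set ℂ} {δ : ℝ} {n : ℕ} {a b : Fin n → ℂ}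
    (h : ∀ i, nearestSite δ (a i) = nearestSite δ (b i)) :
    meshIsingPlusCorr Ω δ a = meshIsingPlusCorr Ω δ b := by
  unfold meshIsingPlusCorr
  congr 2
  funext i
  exact h i

/-! ### Metric facts on configurations -/

/-- Moving one coordinate moves the configuration by at most the same distance. [folklore] -/
theorem dist_update_update_le {n : ℕ} (b : Fin (n + 1) → ℂ) (j : Fin (n + 1)) (z z' : ℂ) :
    dist (Function.update b j z) (Function.update b j z') ≤ dist z z' := by
  refine (dist_pi_le_iff dist_nonneg).2 fun i => ?_
  by_cases hi : i = j
  · subst hi; simp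
  · simp [Function.update_of_ne hi]

/-- Moving one coordinate moves the configuration by at most the displacement. [folklore] -/
theorem dist_update_le {n : ℕ} (b : Fin (n + 1) → ℂ) (j : Fin (n + 1)) (z : ℂ) :
    dist (Function.update b j z) b ≤ dist z (b j) := by
  conv_lhs => rw [← Function.update_eq_self j b]
  rw [Function.update_idem]
  exact dist_update_update_le b j z (b j)

/-- A compact set of configurations of an open `Ω` has a compact neighbourhood of configurations:
all configurations at distance `≤ ρ` from `K` lie in a compact `K' ⊆ Ω̃^{n+1}`. [folklore] -/
theorem exists_compact_cthickening {Ω : Set ℂ} (hΩ : IsOpen Ω) {n : ℕ} {K : Set (Fin (n + 1) → ℂ)}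
    (hK : IsCompact K) (hKΩ : K ⊆ confSet Ω n) :
    ∃ ρ : ℝ, 0 < ρ ∧ ∃ K' : Set (Fin (n + 1) → ℂ), IsCompact K' ∧ K' ⊆ confSet Ω n ∧
      ∀ c, ∀ b ∈ K, dist c b ≤ ρ → c ∈ K' := by
  obtain ⟨ρ, hρ, hsub⟩ := hK.exists_cthickening_subset_open (isOpen_confSet hΩ n) hKΩ
  exact ⟨ρ, hρ, cthickening ρ K, hK.cthickening, hsub,
    fun c b hb hcb => mem_cthickening_of_dist_le c b ρ K hb hcb⟩

/-- Products of numbers close to `1` are close to `1`. [folklore] -/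
theorem abs_mul_sub_one_le {x y ε : ℝ} (hx : |x - 1| ≤ ε) (hy : |y - 1| ≤ ε) (hε : ε ≤ 1) :
    |x * y - 1| ≤ 3 * ε := by
  have h1 : |x| ≤ 2 := by
    calc |x| = |(x - 1) + 1| := by ring_nf
      _ ≤ |x - 1| + |1| := abs_add_le _ _
      _ ≤ ε + 1 := by rw [abs_one]; linarith
      _ ≤ 2 := by linarith
  have h2 : x * y - 1 = x * (y - 1) + (x - 1) := by ring
  rw [h2]
  calc |x * (y - 1) + (x - 1)| ≤ |x * (y - 1)| + |x - 1| := abs_add_le _ _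
    _ = |x| * |y - 1| + |x - 1| := by rw [abs_mul]
    _ ≤ 2 * ε + ε := add_le_add (mul_le_mul h1 hy (abs_nonneg _) (by norm_num)) hx
    _ = 3 * ε := by ring

/-! ### Bounded lattice corrections (CHI Remark 2.18 iterated) -/

section Corrections

variable {Ω : Set ℂ} {n : ℕ}

/-- **Axis steps iterated**: under `CHINeighbourRatio Ω`, for every `k ∈ ℕ` and axis step `e`,
`𝔼⁺_{Ω_δ}[σ at a with a_j ↦ a_j + kδe] / 𝔼⁺_{Ω_δ}[σ at a] → 1` uniformly on compact sets of
configurations. [cite: ChelkakHonglerIzyurovAnnals2015, Remark 2.18] -/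
theorem eventually_ratio_nsmul_axisStep (hΩ : IsOpen Ω) (hM : MeshApproximates Ω) (hN : CHINeighbourRatio Ω)
    (j : Fin (n + 1)) {e : ℂ} (he : e ∈ axisSteps) (k : ℕ) :
    ∀ (K : Set (Fin (n + 1) → ℂ)), IsCompact K → K ⊆ confSet Ω n → ∀ ε : ℝ, 0 < ε →
      ∀ᶠ δ in 𝓝[>] (0 : ℝ), ∀ b ∈ K,
        |meshIsingPlusCorr Ω δ (Function.update b j (b j + k * δ * e)) / meshIsingPlusCorr Ω δ b - 1| ≤ ε := by
  have he1 : ‖e‖ = 1 := by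
    simp only [axisSteps, mem_insert_iff, mem_singleton_iff] at he
    rcases he with rfl | rfl | rfl | rfl <;> simp
  induction k with
  | zero =>
    intro K hK hKΩ ε hε
    filter_upwards [eventually_forall_meshIsingPlusCorr_pos hM hN hK hKΩ] with δ hpos
    intro b hb
    rw [Nat.cast_zero, zero_mul, zero_mul, add_zero, Function.update_eq_self, div_self (hpos b hb).ne',
      sub_self, abs_zero]
    exact hε.le
  | succ k ih =>
    intro K hK hKΩ ε hε
    obtain ⟨ρ, hρ, K', hK', hK'Ω, hmem⟩ := exists_compact_cthickening hΩ hK hKΩ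
    set ε₁ : ℝ := min ε 1 / 3 with hε₁
    have hε₁pos : 0 < ε₁ := by positivity
    have hε₁le : ε₁ ≤ 1 := by
      have := min_le_right ε 1; rw [hε₁]; linarith
    have h3ε₁ : 3 * ε₁ ≤ ε := by
      have := min_le_left ε 1; rw [hε₁]; linarith
    have hδρ : ∀ᶠ δ in 𝓝[>] (0 : ℝ), δ ≤ ρ :=
      (nhdsWithin_le_nhds (s := Ioi (0 : ℝ))) (ge_mem_nhds hρ)
    filter_upwards [ih K' hK' hK'Ω ε₁ hε₁pos, hN n j K hK hKΩ e he ε₁ hε₁pos,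
      eventually_forall_meshIsingPlusCorr_pos hM hN hK' hK'Ω, hδρ, self_mem_nhdsWithin]
      with δ hih hstep hpos' hδρ' hδ0
    intro b hb
    have hδpos : (0 : ℝ) < δ := hδ0
    -- the shifted configuration is in `K'`
    set b' := Function.update b j (b j + δ * e) with hb'
    have hb'K : b' ∈ K' := by
      refine hmem b' b hb ((dist_update_le b j _).trans ?_)
      rw [dist_eq_norm, add_sub_cancel_left, norm_mul, Complex.norm_real, Real.norm_eq_abs,
        abs_of_pos hδpos, he1, mul_one]
      exact hδρ'
    have h1 := hih b' hb'K
    have h2 := hstep b hb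
    have hupd : Function.update b' j (b' j + k * δ * e) = Function.update b j (b j + (k + 1 : ℕ) * δ * e) := by
      rw [hb', Function.update_idem, Function.update_self]
      congr 1
      push_cast
      ring
    rw [hupd] at h1
    have hpos := hpos' b' hb'K
    have hprod : meshIsingPlusCorr Ω δ (Function.update b j (b j + (k + 1 : ℕ) * δ * e)) /
        meshIsingPlusCorr Ω δ b =
        (meshIsingPlusCorr Ω δ (Function.update b j (b j + (k + 1 : ℕ) * δ * e)) / meshIsingPlusCorr Ω δ b') *
          (meshIsingPlusCorr Ω δ b' / meshIsingPlusCorr Ω δ b) := by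
      rw [div_mul_div_cancel₀ hpos.ne']
    rw [hprod]
    exact (abs_mul_sub_one_le h1 h2 hε₁le).trans h3ε₁

/-- **Axis steps iterated, both signs.** [cite: ChelkakHonglerIzyurovAnnals2015, Remark 2.18] -/
theorem eventually_ratio_zsmul_axisStep (hΩ : IsOpen Ω) (hM : MeshApproximates Ω) (hN : CHINeighbourRatio Ω)
    (j : Fin (n + 1)) {e : ℂ} (he : e ∈ axisSteps) (hne : -e ∈ axisSteps) (k : ℤ)
    {K : Set (Fin (n + 1) → ℂ)} (hK : IsCompact K) (hKΩ : K ⊆ confSet Ω n) {ε : ℝ} (hε : 0 < ε) :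
    ∀ᶠ δ in 𝓝[>] (0 : ℝ), ∀ b ∈ K,
      |meshIsingPlusCorr Ω δ (Function.update b j (b j + k * δ * e)) / meshIsingPlusCorr Ω δ b - 1| ≤ ε := by
  obtain ⟨m, rfl | rfl⟩ := Int.eq_nat_or_neg k
  · simpa using eventually_ratio_nsmul_axisStep hΩ hM hN j he m K hK hKΩ ε hε
  · have h := eventually_ratio_nsmul_axisStep hΩ hM hN j hne m K hK hKΩ ε hε
    refine h.mono fun δ hδ b hb => ?_
    have : (((-(m : ℤ) : ℤ) : ℂ)) * δ * e = (m : ℂ) * δ * (-e) := by push_cast; ring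
    rw [this]
    exact hδ b hb

/-- **Bounded lattice corrections**: under `CHINeighbourRatio Ω`, for every fixed lattice vector
`r ∈ ℤ²`, `𝔼⁺_{Ω_δ}[σ at a with a_j ↦ a_j + δr] / 𝔼⁺_{Ω_δ}[σ at a] → 1` uniformly on compact sets of
configurations (`|r|₁` applications of Remark 2.18). [cite: ChelkakHonglerIzyurovAnnals2015, Remark 2.18] -/
theorem eventually_ratio_add_meshPoint (hΩ : IsOpen Ω) (hM : MeshApproximates Ω) (hN : CHINeighbourRatio Ω)
    (j : Fin (n + 1)) (r : Site 2) {K : Set (Fin (n + 1) → ℂ)} (hK : IsCompact K)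
    (hKΩ : K ⊆ confSet Ω n) {ε : ℝ} (hε : 0 < ε) :
    ∀ᶠ δ in 𝓝[>] (0 : ℝ), ∀ b ∈ K,
      |meshIsingPlusCorr Ω δ (Function.update b j (b j + meshPoint δ r)) / meshIsingPlusCorr Ω δ b - 1| ≤ ε := by
  have h1 : (1 : ℂ) ∈ axisSteps := by simp [axisSteps]
  have hn1 : (-1 : ℂ) ∈ axisSteps := by simp [axisSteps]
  have hI : I ∈ axisSteps := by simp [axisSteps]
  have hnI : -I ∈ axisSteps := by simp [axisSteps]
  obtain ⟨ρ, hρ, K', hK', hK'Ω, hmem⟩ := exists_compact_cthickening hΩ hK hKΩ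
  set ε₁ : ℝ := min ε 1 / 3 with hε₁
  have hε₁pos : 0 < ε₁ := by positivity
  have hε₁le : ε₁ ≤ 1 := by
    have := min_le_right ε 1; rw [hε₁]; linarith
  have h3ε₁ : 3 * ε₁ ≤ ε := by
    have := min_le_left ε 1; rw [hε₁]; linarith
  -- eventually `|r 0| δ ≤ ρ`
  have hδρ : ∀ᶠ δ in 𝓝[>] (0 : ℝ), (|(r 0 : ℝ)| + 1) * δ ≤ ρ := by
    have : Tendsto (fun δ : ℝ => (|(r 0 : ℝ)| + 1) * δ) (𝓝 0) (𝓝 ((|(r 0 : ℝ)| + 1) * 0)) :=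
      tendsto_id.const_mul _
    rw [mul_zero] at this
    exact (this.mono_left nhdsWithin_le_nhds).eventually (ge_mem_nhds hρ)
  filter_upwards [eventually_ratio_zsmul_axisStep hΩ hM hN j h1 hn1 (r 0) hK hKΩ hε₁pos,
    eventually_ratio_zsmul_axisStep hΩ hM hN j hI hnI (r 1) hK' hK'Ω hε₁pos,
    eventually_forall_meshIsingPlusCorr_pos hM hN hK' hK'Ω, hδρ, self_mem_nhdsWithin]
    with δ hx hy hpos' hδρ' hδ0
  intro b hb
  have hδpos : (0 : ℝ) < δ := hδ0
  set b' := Function.update b j (b j + (r 0 : ℂ) * δ * 1) with hb'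
  have hb'K : b' ∈ K' := by
    refine hmem b' b hb ((dist_update_le b j _).trans ?_)
    rw [dist_eq_norm, add_sub_cancel_left, mul_one, norm_mul, Complex.norm_real, Real.norm_eq_abs,
      abs_of_pos hδpos, Complex.norm_intCast]
    nlinarith [abs_nonneg (r 0 : ℝ)]
  have hxb := hx b hb
  have hyb := hy b' hb'K
  have hupd : Function.update b' j (b' j + (r 1 : ℂ) * δ * I) = Function.update b j (b j + meshPoint δ r) := by
    rw [hb', Function.update_idem, Function.update_self]
    congr 1
    rw [meshPoint_eq_mul]
    apply Complex.ext <;> simp <;> ring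
  rw [hupd] at hyb
  have hpos := hpos' b' hb'K
  have hprod : meshIsingPlusCorr Ω δ (Function.update b j (b j + meshPoint δ r)) / meshIsingPlusCorr Ω δ b =
      (meshIsingPlusCorr Ω δ (Function.update b j (b j + meshPoint δ r)) / meshIsingPlusCorr Ω δ b') *
        (meshIsingPlusCorr Ω δ b' / meshIsingPlusCorr Ω δ b) := by
    rw [div_mul_div_cancel₀ hpos.ne']
  rw [hprod]
  exact (abs_mul_sub_one_le hyb hxb hε₁le).trans h3ε₁

end Corrections

/-! ### Straight moves of one marked point and their lattice approximations -/

section Move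

variable {n : ℕ}

/-- The straight move of the `j`-th marked point in the direction `u`: `s ↦ (a with a_j + s u)`.
[cite: ChelkakHonglerIzyurovAnnals2015, §2.8, proof of Prop. 2.20] -/
def moveConf (a : Fin (n + 1) → ℂ) (j : Fin (n + 1)) (u : ℂ) (s : ℝ) : Fin (n + 1) → ℂ :=
  Function.update a j (a j + s * u)

/-- The move at time `0` is the configuration itself. [folklore] -/
theorem moveConf_zero (a : Fin (n + 1) → ℂ) (j : Fin (n + 1)) (u : ℂ) : moveConf a j u 0 = a := by
  simp [moveConf]

/-- The `j`-th point of the moved configuration. [folklore] -/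
theorem moveConf_apply_self (a : Fin (n + 1) → ℂ) (j : Fin (n + 1)) (u : ℂ) (s : ℝ) :
    moveConf a j u s j = a j + s * u := by
  simp [moveConf]

/-- The other points do not move. [folklore] -/
theorem moveConf_apply_of_ne (a : Fin (n + 1) → ℂ) {j i : Fin (n + 1)} (h : i ≠ j) (u : ℂ) (s : ℝ) :
    moveConf a j u s i = a i := by
  simp [moveConf, Function.update_of_ne h]

/-- The move is continuous in time. [folklore] -/
theorem continuous_moveConf (a : Fin (n + 1) → ℂ) (j : Fin (n + 1)) (u : ℂ) :
    Continuous (moveConf a j u) := by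
  refine continuous_pi fun i => ?_
  by_cases hi : i = j
  · subst hi
    simp only [moveConf_apply_self]
    exact continuous_const.add (Complex.continuous_ofReal.mul continuous_const)
  · simp only [moveConf_apply_of_ne a hi]
    exact continuous_const

/-- Mesh points are additive. [folklore] -/
theorem meshPoint_add' (δ : ℝ) (x y : Site 2) : meshPoint δ (x + y) = meshPoint δ x + meshPoint δ y := by
  apply Complex.ext <;> simp [meshPoint_re, meshPoint_im] <;> ring

/-- Mesh points of multiples: `δ(m s) = m δ s`. [folklore] -/
theorem meshPoint_nsmul (δ : ℝ) (m : ℕ) (s : Site 2) :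
    meshPoint δ (m • s) = (m : ℂ) * ((δ : ℂ) * Site.toComplex s) := by
  apply Complex.ext <;> simp [meshPoint_re, meshPoint_im] <;> ring

/-- Mesh points of differences. [folklore] -/
theorem meshPoint_sub' (δ : ℝ) (x y : Site 2) : meshPoint δ (x - y) = meshPoint δ x - meshPoint δ y := by
  apply Complex.ext <;> simp [meshPoint_re, meshPoint_im] <;> ring

/-- The coordinates of a lattice vector are bounded by the norm of its mesh point: `δ |r i| ≤ |δ r|`.
[folklore] -/
theorem mul_abs_le_norm_meshPoint {δ : ℝ} (hδ : 0 ≤ δ) (r : Site 2) (i : Fin 2) :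
    δ * |(r i : ℝ)| ≤ ‖meshPoint δ r‖ := by
  fin_cases i
  · have := Complex.abs_re_le_norm (meshPoint δ r)
    rw [meshPoint_re, abs_mul, abs_of_nonneg hδ] at this
    exact this
  · have := Complex.abs_im_le_norm (meshPoint δ r)
    rw [meshPoint_im, abs_mul, abs_of_nonneg hδ] at this
    exact this

/-- **The lattice approximation of a straight move**: the configuration `a` with `a_j` replaced by
the mesh point `δ([a_j/δ] + m s)` (`m` diagonal steps `s` from the rounded starting point).
[cite: ChelkakHonglerIzyurovAnnals2015, §2.8 ("a straight horizontal lattice path approximating [a₀, a₀']")] -/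
def latticeConf (a : Fin (n + 1) → ℂ) (j : Fin (n + 1)) (s : Site 2) (δ : ℝ) (m : ℕ) : Fin (n + 1) → ℂ :=
  Function.update a j (meshPoint δ (nearestSite δ (a j) + m • s))

/-- One more lattice step is the diagonal step `δ u` of the `j`-th point. [folklore] -/
theorem latticeConf_succ (a : Fin (n + 1) → ℂ) (j : Fin (n + 1)) (s : Site 2) (δ : ℝ) (m : ℕ) :
    latticeConf a j s δ (m + 1) =
      Function.update (latticeConf a j s δ m) j
        (latticeConf a j s δ m j + δ * Site.toComplex s) := by
  unfold latticeConf
  rw [Function.update_idem, Function.update_self]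
  congr 1
  rw [add_smul, one_smul, ← add_assoc, meshPoint_add' δ _ s]
  rfl

/-- The `j`-th point of the lattice configuration: `δ[a_j/δ] + m δ u`. [folklore] -/
theorem latticeConf_apply_self (a : Fin (n + 1) → ℂ) (j : Fin (n + 1)) (s : Site 2) (δ : ℝ) (m : ℕ) :
    latticeConf a j s δ m j = meshPoint δ (nearestSite δ (a j)) + (m : ℂ) * ((δ : ℂ) * Site.toComplex s) := by
  unfold latticeConf
  rw [Function.update_self, meshPoint_add', meshPoint_nsmul]

/-- **The lattice configuration is `δ`-close to the straight move** at time `m δ`. [folklore] -/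
theorem dist_latticeConf_moveConf_le (a : Fin (n + 1) → ℂ) (j : Fin (n + 1)) {s : Site 2} {u : ℂ}
    (hsu : Site.toComplex s = u) {δ : ℝ} (hδ : 0 < δ) (m : ℕ) :
    dist (latticeConf a j s δ m) (moveConf a j u (m * δ)) ≤ δ := by
  unfold latticeConf moveConf
  refine (dist_update_update_le a j _ _).trans ?_
  rw [meshPoint_add', meshPoint_nsmul, hsu, dist_eq_norm]
  have : meshPoint δ (nearestSite δ (a j)) + (m : ℂ) * ((δ : ℂ) * u) - (a j + ((m * δ : ℝ) : ℂ) * u) =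
      meshPoint δ (nearestSite δ (a j)) - a j := by push_cast; ring
  rw [this, ← dist_eq_norm]
  exact dist_meshPoint_nearestSite_le hδ (a j)

/-- At `m = 0` the lattice configuration has the same rounded sites as `a`. [folklore] -/
theorem meshIsingPlusCorr_latticeConf_zero (Ω : Set ℂ) (a : Fin (n + 1) → ℂ) (j : Fin (n + 1))
    (s : Site 2) {δ : ℝ} (hδ : δ ≠ 0) :
    meshIsingPlusCorr Ω δ (latticeConf a j s δ 0) = meshIsingPlusCorr Ω δ a := by
  refine meshIsingPlusCorr_congr_sites fun i => ?_
  unfold latticeConf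
  by_cases hi : i = j
  · subst hi
    rw [Function.update_self, zero_smul, add_zero, nearestSite_meshPoint hδ]
  · rw [Function.update_of_ne hi]

/-- **The endpoint correction is a bounded lattice vector**: with `N = ⌊t/δ⌋` and
`r = [b_j/δ] - ([a_j/δ] + N s)`, `b = (a with a_j + t u)`, one has `|r_i| ≤ 3`, and the endpoint `b`
has the same rounded sites as the lattice configuration `N` shifted by `δ r`. [folklore] -/
theorem endpoint_correction (a : Fin (n + 1) → ℂ) (j : Fin (n + 1)) {s : Site 2} {u : ℂ}
    (hsu : Site.toComplex s = u) (hu2 : ‖u‖ ≤ 2) {t δ : ℝ} (ht : 0 ≤ t) (hδ : 0 < δ) :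
    let N := ⌊t / δ⌋₊
    let r : Site 2 := nearestSite δ (moveConf a j u t j) - (nearestSite δ (a j) + N • s)
    (∀ i, r i ∈ Set.Icc (-3 : ℤ) 3) ∧
      (∀ (Ω : Set ℂ), meshIsingPlusCorr Ω δ (moveConf a j u t) =
        meshIsingPlusCorr Ω δ (Function.update (latticeConf a j s δ N) j
          (latticeConf a j s δ N j + meshPoint δ r))) := by
  intro N r
  constructor
  · intro i
    -- `‖δ r‖ < 4δ`
    have hNle : (N : ℝ) * δ ≤ t := by
      have := Nat.floor_le (show 0 ≤ t / δ by positivity)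
      calc (N : ℝ) * δ ≤ t / δ * δ := mul_le_mul_of_nonneg_right this hδ.le
        _ = t := div_mul_cancel₀ t hδ.ne'
    have hNgt : t - δ < (N : ℝ) * δ := by
      have := Nat.lt_floor_add_one (t / δ)
      have h' : t / δ * δ < ((N : ℝ) + 1) * δ := mul_lt_mul_of_pos_right this hδ
      rw [div_mul_cancel₀ t hδ.ne'] at h'
      linarith
    have hnorm : ‖meshPoint δ r‖ < 4 * δ := by
      have h1 : meshPoint δ r = (meshPoint δ (nearestSite δ (moveConf a j u t j)) - moveConf a j u t j) +
          (a j - meshPoint δ (nearestSite δ (a j))) + (((t - N * δ : ℝ) : ℂ) * u) := by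
        show meshPoint δ (nearestSite δ (moveConf a j u t j) - (nearestSite δ (a j) + N • s)) = _
        rw [meshPoint_sub', meshPoint_add', meshPoint_nsmul, hsu, moveConf_apply_self]
        push_cast
        ring
      rw [h1]
      have e1 : ‖meshPoint δ (nearestSite δ (moveConf a j u t j)) - moveConf a j u t j‖ ≤ δ := by
        rw [← dist_eq_norm]; exact dist_meshPoint_nearestSite_le hδ _
      have e2 : ‖a j - meshPoint δ (nearestSite δ (a j))‖ ≤ δ := by
        rw [← dist_eq_norm, dist_comm]; exact dist_meshPoint_nearestSite_le hδ _
      have e3 : ‖((t - N * δ : ℝ) : ℂ) * u‖ < 2 * δ := by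
        rw [norm_mul, Complex.norm_real, Real.norm_eq_abs, abs_of_nonneg (by linarith)]
        calc (t - N * δ) * ‖u‖ ≤ (t - N * δ) * 2 := by
              apply mul_le_mul_of_nonneg_left hu2; linarith
          _ < δ * 2 := by apply mul_lt_mul_of_pos_right _ two_pos; linarith
          _ = 2 * δ := by ring
      calc ‖(meshPoint δ (nearestSite δ (moveConf a j u t j)) - moveConf a j u t j) +
            (a j - meshPoint δ (nearestSite δ (a j))) + (((t - N * δ : ℝ) : ℂ) * u)‖
          ≤ ‖meshPoint δ (nearestSite δ (moveConf a j u t j)) - moveConf a j u t j‖ +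
            ‖a j - meshPoint δ (nearestSite δ (a j))‖ + ‖((t - N * δ : ℝ) : ℂ) * u‖ := norm_add₃_le
        _ < δ + δ + 2 * δ := by linarith
        _ = 4 * δ := by ring
    have hi : δ * |(r i : ℝ)| < 4 * δ := lt_of_le_of_lt (mul_abs_le_norm_meshPoint hδ.le r i) hnorm
    have hi' : |(r i : ℝ)| < 4 := by nlinarith
    have hi'' : |r i| ≤ 3 := by
      have h4 : ((|r i| : ℤ) : ℝ) < 4 := by rw [Int.cast_abs]; exact hi'
      have h5 : |r i| < 4 := by exact_mod_cast h4
      omega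
    exact ⟨(abs_le.1 hi'').1, (abs_le.1 hi'').2⟩
  · intro Ω
    refine meshIsingPlusCorr_congr_sites fun i => ?_
    by_cases hi : i = j
    · subst hi
      rw [Function.update_self]
      unfold latticeConf
      rw [Function.update_self, ← meshPoint_add', nearestSite_meshPoint hδ.ne']
      show nearestSite δ (moveConf a i u t i) = nearestSite δ (a i) + N • s + r
      simp only [r]
      abel
    · rw [Function.update_of_ne hi]
      unfold latticeConf moveConf
      rw [Function.update_of_ne hi, Function.update_of_ne hi]

end Move

/-! ### The single straight move: `𝔼[σ at b]/𝔼[σ at a] → exp ∫ Re(𝒜_j u)` -/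

section MoveLimit

variable {Ω : Set ℂ} {n : ℕ} {𝒜 : (n : ℕ) → Fin (n + 1) → (Fin (n + 1) → ℂ) → ℂ}

/-- `⌊t/δ⌋ δ → t` as `δ → 0⁺`. [folklore] -/
theorem tendsto_natFloor_mul_self {t : ℝ} (ht : 0 ≤ t) :
    Tendsto (fun δ : ℝ => (⌊t / δ⌋₊ : ℝ) * δ) (𝓝[>] 0) (𝓝 t) := by
  have hlow : Tendsto (fun δ : ℝ => t - δ) (𝓝[>] 0) (𝓝 t) := by
    have : Tendsto (fun δ : ℝ => t - δ) (𝓝 0) (𝓝 (t - 0)) := tendsto_const_nhds.sub tendsto_id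
    rw [sub_zero] at this
    exact this.mono_left nhdsWithin_le_nhds
  refine tendsto_of_tendsto_of_tendsto_of_le_of_le' hlow tendsto_const_nhds ?_ ?_
  · filter_upwards [self_mem_nhdsWithin] with δ hδ
    have hδ' : (0 : ℝ) < δ := hδ
    have := Nat.lt_floor_add_one (t / δ)
    have h' : t / δ * δ < ((⌊t / δ⌋₊ : ℝ) + 1) * δ := mul_lt_mul_of_pos_right this hδ'
    rw [div_mul_cancel₀ t hδ'.ne'] at h'
    linarith
  · filter_upwards [self_mem_nhdsWithin] with δ hδ
    have hδ' : (0 : ℝ) < δ := hδ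
    have := Nat.floor_le (show 0 ≤ t / δ by positivity)
    calc (⌊t / δ⌋₊ : ℝ) * δ ≤ t / δ * δ := mul_le_mul_of_nonneg_right this hδ'.le
      _ = t := div_mul_cancel₀ t hδ'.ne'

/-- `⌊t/δ⌋ δ ≤ t` for `δ > 0`. [folklore] -/
theorem floor_mul_le {t δ : ℝ} (ht : 0 ≤ t) (hδ : 0 < δ) : (⌊t / δ⌋₊ : ℝ) * δ ≤ t := by
  have := Nat.floor_le (show 0 ≤ t / δ by positivity)
  calc (⌊t / δ⌋₊ : ℝ) * δ ≤ t / δ * δ := mul_le_mul_of_nonneg_right this hδ.le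
    _ = t := div_mul_cancel₀ t hδ.ne'

/-- **The straight move, logarithmic form.** Under CHI Thm 1.5 (`CHILogDerivative`) and Remark 2.18
(`CHINeighbourRatio`) in an admissible approximable `Ω`, with `𝒜` continuous on the configuration
space: if the `j`-th point moves from `a_j` to `a_j + t u` (`u` a diagonal step, `t ≥ 0`) inside the
configuration space, then
`log 𝔼⁺_{Ω_δ}[σ at (a with a_j + tu)] - log 𝔼⁺_{Ω_δ}[σ at a] → ∫_0^t Re(𝒜_j(a with a_j + su) u) ds`
(integration of the discrete logarithmic derivative along the lattice path `δ[a_j/δ] + mδu`,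
Riemann sums, and a bounded endpoint correction).
[cite: ChelkakHonglerIzyurovAnnals2015, §2.8, proof of Prop. 2.20] -/
theorem tendsto_log_sub_log_moveConf (hΩ : IsAdmissibleDomain Ω) (hM : MeshApproximates Ω)
    (h𝒜 : ∀ (n : ℕ) (j : Fin (n + 1)), ContinuousOn (𝒜 n j) (confSet Ω n))
    (hD : CHILogDerivative Ω 𝒜) (hN : CHINeighbourRatio Ω)
    {a : Fin (n + 1) → ℂ} {j : Fin (n + 1)} {u : ℂ} (hu : u ∈ diagSteps) {t : ℝ} (ht : 0 ≤ t)
    (hseg : ∀ s ∈ Icc (0 : ℝ) t, moveConf a j u s ∈ confSet Ω n) :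
    Tendsto (fun δ => Real.log (meshIsingPlusCorr Ω δ (moveConf a j u t)) -
        Real.log (meshIsingPlusCorr Ω δ a)) (𝓝[>] 0)
      (𝓝 (∫ s in (0 : ℝ)..t, (𝒜 n j (moveConf a j u s) * u).re)) := by
  have hΩo : IsOpen Ω := hΩ.1
  have hu2 : ‖u‖ ≤ 2 := norm_le_two_of_mem_diagSteps hu
  obtain ⟨sv, hsv⟩ := exists_site_of_mem_diagSteps hu
  -- a compact neighbourhood `K` of the segment of configurations
  have hγc : Continuous (moveConf a j u) := continuous_moveConf a j u
  set S : Set (Fin (n + 1) → ℂ) := moveConf a j u '' Icc 0 t with hS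
  have hSc : IsCompact S := isCompact_Icc.image hγc
  have hSΩ : S ⊆ confSet Ω n := by
    rintro _ ⟨s, hs, rfl⟩; exact hseg s hs
  obtain ⟨ρ, hρ, K, hK, hKΩ, hmem⟩ := exists_compact_cthickening hΩo hSc hSΩ
  have hmemK : ∀ c (s : ℝ), s ∈ Icc (0 : ℝ) t → dist c (moveConf a j u s) ≤ ρ → c ∈ K :=
    fun c s hs h => hmem c _ ⟨s, hs, rfl⟩ h
  have hγK : ∀ s ∈ Icc (0 : ℝ) t, moveConf a j u s ∈ K := fun s hs =>
    hmemK _ s hs (by rw [dist_self]; exact hρ.le)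
  -- notation
  set N : ℝ → ℕ := fun δ => ⌊t / δ⌋₊ with hNdef
  set c : ℝ → ℕ → (Fin (n + 1) → ℂ) := fun δ m => latticeConf a j sv δ m with hcdef
  set E : ℝ → (Fin (n + 1) → ℂ) → ℝ := fun δ x => meshIsingPlusCorr Ω δ x with hEdef
  -- lattice configurations with `m ≤ N δ` are in `K` once `δ ≤ ρ`
  have hcK : ∀ δ : ℝ, 0 < δ → δ ≤ ρ → ∀ m ≤ N δ, c δ m ∈ K := by
    intro δ hδ hδρ m hm
    have hmδ : (m : ℝ) * δ ∈ Icc (0 : ℝ) t := by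
      refine ⟨by positivity, ?_⟩
      calc (m : ℝ) * δ ≤ (N δ : ℝ) * δ := by gcongr
        _ ≤ t := floor_mul_le ht hδ
    exact hmemK _ _ hmδ ((dist_latticeConf_moveConf_le a j hsv hδ m).trans hδρ)
  have hδρ : ∀ᶠ δ in 𝓝[>] (0 : ℝ), δ ≤ ρ :=
    (nhdsWithin_le_nhds (s := Ioi (0 : ℝ))) (ge_mem_nhds hρ)
  -- a bound for `𝒜` on `K`
  obtain ⟨M₀, hM₀⟩ := hK.exists_bound_of_continuousOn ((h𝒜 n j).mono hKΩ)
  have hM₀' : 0 ≤ M₀ := by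
    have := hM₀ _ (hγK 0 ⟨le_rfl, ht⟩); exact (norm_nonneg _).trans this
  -- the integrand, clamped to `[0, t]`
  set clamp : ℝ → ℝ := fun s => max 0 (min s t) with hclamp
  have hclampc : Continuous clamp := continuous_const.max (continuous_id.min continuous_const)
  have hclampI : ∀ s, clamp s ∈ Icc (0 : ℝ) t := fun s =>
    ⟨le_max_left _ _, max_le ht (min_le_right _ _)⟩
  have hclampid : ∀ s ∈ Icc (0 : ℝ) t, clamp s = s := fun s hs => by
    rw [hclamp]; simp only; rw [min_eq_left hs.2, max_eq_right hs.1]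
  set f : ℝ → ℝ := fun s => (𝒜 n j (moveConf a j u (clamp s)) * u).re with hfdef
  have hfc : Continuous f := by
    have h1 : Continuous fun s => 𝒜 n j (moveConf a j u (clamp s)) :=
      (h𝒜 n j).comp_continuous (hγc.comp hclampc) fun s => hseg _ (hclampI s)
    exact (Complex.continuous_re.comp (h1.mul continuous_const))
  -- (1) the Riemann sums
  have hR : Tendsto (fun δ => δ * ∑ m ∈ Finset.range (N δ), f (m * δ)) (𝓝[>] 0)
      (𝓝 (∫ s in (0 : ℝ)..t, f s)) :=
    Literature.Analysis.Asymptotics.tendsto_mul_sum_range_intervalIntegral hfc ht tendsto_id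
      (tendsto_natFloor_mul_self ht)
  have hint : (∫ s in (0 : ℝ)..t, f s) = ∫ s in (0 : ℝ)..t, (𝒜 n j (moveConf a j u s) * u).re := by
    refine intervalIntegral.integral_congr fun s hs => ?_
    rw [uIcc_of_le ht] at hs
    simp only [hfdef, hclampid s hs]
  rw [← hint]
  -- (2) the slopes `g` along the lattice path and their comparison with `f`
  set g : ℝ → ℕ → ℝ := fun δ m => (𝒜 n j (c δ m) * u).re with hgdef
  have hg : ∀ᶠ δ in 𝓝[>] (0 : ℝ), ∀ m < N δ, |g δ m| ≤ 2 * M₀ := by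
    filter_upwards [hδρ, self_mem_nhdsWithin] with δ hδρ' hδ0 m hm
    have hcm := hcK δ hδ0 hδρ' m hm.le
    calc |g δ m| ≤ ‖𝒜 n j (c δ m) * u‖ := Complex.abs_re_le_norm _
      _ = ‖𝒜 n j (c δ m)‖ * ‖u‖ := norm_mul _ _
      _ ≤ M₀ * 2 := mul_le_mul (hM₀ _ hcm) hu2 (norm_nonneg _) hM₀'
      _ = 2 * M₀ := by ring
  have hgf : Tendsto (fun δ => δ * ∑ m ∈ Finset.range (N δ), g δ m - δ * ∑ m ∈ Finset.range (N δ), f (m * δ))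
      (𝓝[>] 0) (𝓝 0) := by
    rw [Metric.tendsto_nhds]
    intro ε hε
    have huc : UniformContinuousOn (𝒜 n j) K := hK.uniformContinuousOn_of_continuous ((h𝒜 n j).mono hKΩ)
    rw [Metric.uniformContinuousOn_iff] at huc
    obtain ⟨η, hη, hηA⟩ := huc (ε / (2 * t + 1)) (by positivity)
    have hδη : ∀ᶠ δ in 𝓝[>] (0 : ℝ), δ < η :=
      (nhdsWithin_le_nhds (s := Ioi (0 : ℝ))) (gt_mem_nhds hη)
    filter_upwards [hδρ, hδη, self_mem_nhdsWithin] with δ hδρ' hδη' hδ0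
    have hδpos : (0 : ℝ) < δ := hδ0
    rw [Real.dist_eq, sub_zero, ← mul_sub, ← Finset.sum_sub_distrib, abs_mul, abs_of_pos hδpos]
    have hterm : ∀ m < N δ, |g δ m - f (m * δ)| ≤ 2 * (ε / (2 * t + 1)) := by
      intro m hm
      have hmδ : (m : ℝ) * δ ∈ Icc (0 : ℝ) t :=
        ⟨by positivity, le_trans (by gcongr) (floor_mul_le ht hδpos)⟩
      have hcm := hcK δ hδpos hδρ' m hm.le
      have hγm := hγK _ hmδ
      have hd : dist (c δ m) (moveConf a j u (m * δ)) < η :=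
        lt_of_le_of_lt (dist_latticeConf_moveConf_le a j hsv hδpos m) hδη'
      have hA := hηA _ hcm _ hγm hd
      rw [dist_eq_norm] at hA
      simp only [hgdef, hfdef, hclampid _ hmδ]
      rw [← Complex.sub_re, ← sub_mul]
      calc |((𝒜 n j (c δ m) - 𝒜 n j (moveConf a j u (m * δ))) * u).re|
          ≤ ‖(𝒜 n j (c δ m) - 𝒜 n j (moveConf a j u (m * δ))) * u‖ := Complex.abs_re_le_norm _
        _ = ‖𝒜 n j (c δ m) - 𝒜 n j (moveConf a j u (m * δ))‖ * ‖u‖ := norm_mul _ _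
        _ ≤ ε / (2 * t + 1) * 2 := mul_le_mul hA.le hu2 (norm_nonneg _) (by positivity)
        _ = 2 * (ε / (2 * t + 1)) := by ring
    calc δ * |∑ m ∈ Finset.range (N δ), (g δ m - f (m * δ))|
        ≤ δ * ∑ m ∈ Finset.range (N δ), |g δ m - f (m * δ)| :=
          mul_le_mul_of_nonneg_left (Finset.abs_sum_le_sum_abs _ _) hδpos.le
      _ ≤ δ * ∑ _m ∈ Finset.range (N δ), 2 * (ε / (2 * t + 1)) := by
          gcongr with m hm
          exact hterm m (Finset.mem_range.1 hm)
      _ = (N δ : ℝ) * δ * (2 * (ε / (2 * t + 1))) := by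
          rw [Finset.sum_const, Finset.card_range, nsmul_eq_mul]; ring
      _ ≤ t * (2 * (ε / (2 * t + 1))) := by
          apply mul_le_mul_of_nonneg_right (floor_mul_le ht hδpos); positivity
      _ < ε := by
          rw [← mul_assoc, mul_div_assoc', div_lt_iff₀ (by positivity)]; nlinarith
  -- (3) the step ratios `q` and CHI Thm 1.5
  set q : ℝ → ℕ → ℝ := fun δ m => E δ (c δ (m + 1)) / E δ (c δ m) with hqdef
  have hq : ∀ ε : ℝ, 0 < ε → ∀ᶠ δ in 𝓝[>] (0 : ℝ), ∀ m < N δ, |(q δ m - 1) / δ - g δ m| ≤ ε := by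
    intro ε hε
    filter_upwards [hD n j K hK hKΩ u hu ε hε, hδρ, self_mem_nhdsWithin] with δ hδ hδρ' hδ0 m hm
    have hcm := hcK δ hδ0 hδρ' m hm.le
    have := hδ (c δ m) hcm
    simp only [hqdef, hgdef, hEdef, hcdef]
    rw [latticeConf_succ, hsv]
    exact this
  have hNt : ∀ᶠ δ in 𝓝[>] (0 : ℝ), (N δ : ℝ) * δ ≤ t := by
    filter_upwards [self_mem_nhdsWithin] with δ hδ using floor_mul_le ht hδ
  have hA := Literature.Analysis.Asymptotics.tendsto_sum_log_sub_mul_sum hNt hg hq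
  -- (4) telescoping: `∑ log q = log E(c N) - log E(c 0) = log E(c N) - log E(a)`
  have htel : ∀ᶠ δ in 𝓝[>] (0 : ℝ), ∑ m ∈ Finset.range (N δ), Real.log (q δ m) =
      Real.log (E δ (c δ (N δ))) - Real.log (E δ a) := by
    filter_upwards [eventually_forall_meshIsingPlusCorr_pos hM hN hK hKΩ, hδρ, self_mem_nhdsWithin]
      with δ hpos hδρ' hδ0
    have hδpos : (0 : ℝ) < δ := hδ0
    rw [Literature.Analysis.Asymptotics.sum_range_log_div (x := fun m => E δ (c δ m))
      (fun m hm => hpos _ (hcK δ hδpos hδρ' m hm))]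
    simp only [hEdef, hcdef]
    rw [meshIsingPlusCorr_latticeConf_zero Ω a j sv hδpos.ne']
  -- (5) the endpoint correction: `log E(b) - log E(c N) → 0`
  have hcorr : Tendsto (fun δ => Real.log (E δ (moveConf a j u t)) - Real.log (E δ (c δ (N δ)))) (𝓝[>] 0)
      (𝓝 0) := by
    set F : Set (Site 2) := Set.pi univ fun _ : Fin 2 => Set.Icc (-3 : ℤ) 3 with hF
    have hFfin : F.Finite := Set.Finite.pi fun _ => Set.finite_Icc _ _
    -- the ratio `E(b)/E(c N) → 1`
    have hratio : Tendsto (fun δ => E δ (moveConf a j u t) / E δ (c δ (N δ))) (𝓝[>] 0) (𝓝 1) := by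
      rw [Metric.tendsto_nhds]
      intro ε hε
      have hall : ∀ᶠ δ in 𝓝[>] (0 : ℝ), ∀ r ∈ F, ∀ b ∈ K,
          |meshIsingPlusCorr Ω δ (Function.update b j (b j + meshPoint δ r)) / meshIsingPlusCorr Ω δ b - 1|
            ≤ ε / 2 :=
        (hFfin.eventually_all).2 fun r _ =>
          eventually_ratio_add_meshPoint hΩo hM hN j r hK hKΩ (half_pos hε)
      filter_upwards [hall, hδρ, self_mem_nhdsWithin] with δ hδ hδρ' hδ0
      have hδpos : (0 : ℝ) < δ := hδ0
      obtain ⟨hrF, hEq⟩ := endpoint_correction a j hsv hu2 ht hδpos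
      rw [Real.dist_eq]
      have hcN := hcK δ hδpos hδρ' (N δ) le_rfl
      have := hδ _ (Set.mem_univ_pi.2 hrF) (c δ (N δ)) hcN
      simp only [hEdef]
      rw [hEq Ω]
      exact lt_of_le_of_lt this (half_lt_self hε)
    have hpos1 : ∀ᶠ δ in 𝓝[>] (0 : ℝ), 0 < E δ (moveConf a j u t) ∧ 0 < E δ (c δ (N δ)) := by
      filter_upwards [eventually_forall_meshIsingPlusCorr_pos hM hN hK hKΩ, hδρ, self_mem_nhdsWithin]
        with δ hpos hδρ' hδ0
      exact ⟨hpos _ (hγK t ⟨ht, le_rfl⟩), hpos _ (hcK δ hδ0 hδρ' (N δ) le_rfl)⟩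
    have hlog := (Real.continuousAt_log one_ne_zero).tendsto.comp hratio
    rw [Real.log_one] at hlog
    refine hlog.congr' ?_
    filter_upwards [hpos1] with δ ⟨h1, h2⟩
    simp only [Function.comp]
    rw [Real.log_div h1.ne' h2.ne']
  -- (6) assemble
  have hsum : Tendsto (fun δ => (∑ m ∈ Finset.range (N δ), Real.log (q δ m) -
      δ * ∑ m ∈ Finset.range (N δ), g δ m) +
      (δ * ∑ m ∈ Finset.range (N δ), g δ m - δ * ∑ m ∈ Finset.range (N δ), f (m * δ)) +
      δ * ∑ m ∈ Finset.range (N δ), f (m * δ) +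
      (Real.log (E δ (moveConf a j u t)) - Real.log (E δ (c δ (N δ))))) (𝓝[>] 0)
      (𝓝 (0 + 0 + (∫ s in (0 : ℝ)..t, f s) + 0)) :=
    ((hA.add hgf).add hR).add hcorr
  rw [zero_add, zero_add, add_zero] at hsum
  refine hsum.congr' ?_
  filter_upwards [htel] with δ hδ
  rw [hδ]
  ring

/-- **The straight move (CHI §2.8): convergence of the ratio of correlations.** Under CHI Thm 1.5
and Remark 2.18 in an admissible approximable `Ω`, with `𝒜` continuous on the configuration space,
`𝔼⁺_{Ω_δ}[σ at (a with a_j + tu)] / 𝔼⁺_{Ω_δ}[σ at a] → exp(∫_0^t Re(𝒜_j(a with a_j + su) u) ds)`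
whenever the straight move of the `j`-th point stays in the configuration space.
[cite: ChelkakHonglerIzyurovAnnals2015, §2.8, proof of Prop. 2.20] -/
theorem tendsto_ratio_moveConf (hΩ : IsAdmissibleDomain Ω) (hM : MeshApproximates Ω)
    (h𝒜 : ∀ (n : ℕ) (j : Fin (n + 1)), ContinuousOn (𝒜 n j) (confSet Ω n))
    (hD : CHILogDerivative Ω 𝒜) (hN : CHINeighbourRatio Ω)
    {a : Fin (n + 1) → ℂ} {j : Fin (n + 1)} {u : ℂ} (hu : u ∈ diagSteps) {t : ℝ} (ht : 0 ≤ t)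
    (hseg : ∀ s ∈ Icc (0 : ℝ) t, moveConf a j u s ∈ confSet Ω n) :
    Tendsto (fun δ => meshIsingPlusCorr Ω δ (moveConf a j u t) / meshIsingPlusCorr Ω δ a) (𝓝[>] 0)
      (𝓝 (Real.exp (∫ s in (0 : ℝ)..t, (𝒜 n j (moveConf a j u s) * u).re))) := by
  have hlog := tendsto_log_sub_log_moveConf hΩ hM h𝒜 hD hN hu ht hseg
  have hexp := (Real.continuous_exp.tendsto _).comp hlog
  -- positivity at the two endpoints (a compact pair of configurations)
  have hpair : IsCompact ({a, moveConf a j u t} : Set (Fin (n + 1) → ℂ)) :=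
    (Set.finite_singleton _).isCompact.insert a
  have hpairΩ : ({a, moveConf a j u t} : Set (Fin (n + 1) → ℂ)) ⊆ confSet Ω n := by
    intro x hx
    rcases hx with rfl | rfl
    · rw [← moveConf_zero x j u]; exact hseg 0 ⟨le_rfl, ht⟩
    · exact hseg t ⟨ht, le_rfl⟩
  refine hexp.congr' ?_
  filter_upwards [eventually_forall_meshIsingPlusCorr_pos hM hN hpair hpairΩ] with δ hpos
  have h1 := hpos a (mem_insert _ _)
  have h2 := hpos (moveConf a j u t) (mem_insert_of_mem _ (mem_singleton _))
  simp only [Function.comp]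
  rw [Real.exp_sub, Real.exp_log h2, Real.exp_log h1]

end MoveLimit

/-! ### Assembly: CHI Proposition 2.20 (existence of the ratio limits) -/

section Assembly

open Literature.Topology.Euclidean

variable {Ω : Set ℂ} {n : ℕ} {𝒜 : (n : ℕ) → Fin (n + 1) → (Fin (n + 1) → ℂ) → ℂ}

/-- Two configurations are *joined by a ratio limit* if `𝔼⁺_{Ω_δ}[σ at b]/𝔼⁺_{Ω_δ}[σ at a]` has a
positive limit as `δ → 0⁺` (the conclusion of CHI Prop. 2.20 for the pair).
[cite: ChelkakHonglerIzyurovAnnals2015, Prop. 2.20] -/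
def RatioConn (Ω : Set ℂ) {n : ℕ} (a b : Fin (n + 1) → ℂ) : Prop :=
  ∃ r : ℝ, 0 < r ∧
    Tendsto (fun δ => meshIsingPlusCorr Ω δ b / meshIsingPlusCorr Ω δ a) (𝓝[>] 0) (𝓝 r)

/-- A configuration of `Ω̃^{n+1}` is a compact subset of it. [folklore] -/
theorem isCompact_singleton_conf (a : Fin (n + 1) → ℂ) : IsCompact ({a} : Set (Fin (n + 1) → ℂ)) :=
  isCompact_singleton

/-- `RatioConn` is reflexive on the configuration space (the ratio is eventually `1`).
[cite: ChelkakHonglerIzyurovAnnals2015, Prop. 2.20] -/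
theorem RatioConn.refl (hM : MeshApproximates Ω) (hN : CHINeighbourRatio Ω) {a : Fin (n + 1) → ℂ}
    (ha : a ∈ confSet Ω n) : RatioConn Ω a a := by
  refine ⟨1, one_pos, tendsto_const_nhds.congr' ?_⟩
  filter_upwards [eventually_forall_meshIsingPlusCorr_pos hM hN (isCompact_singleton_conf a)
    (singleton_subset_iff.2 ha)] with δ hδ
  rw [div_self (hδ a (mem_singleton a)).ne']

/-- `RatioConn` is symmetric. [cite: ChelkakHonglerIzyurovAnnals2015, Prop. 2.20] -/
theorem RatioConn.symm {a b : Fin (n + 1) → ℂ} (h : RatioConn Ω a b) : RatioConn Ω b a := by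
  obtain ⟨r, hr, ht⟩ := h
  refine ⟨r⁻¹, inv_pos.2 hr, ?_⟩
  have := ht.inv₀ hr.ne'
  refine this.congr' (Eventually.of_forall fun δ => ?_)
  simp only [inv_div]

/-- `RatioConn` is transitive (through a configuration of the configuration space).
[cite: ChelkakHonglerIzyurovAnnals2015, Prop. 2.20] -/
theorem RatioConn.trans (hM : MeshApproximates Ω) (hN : CHINeighbourRatio Ω) {a b c : Fin (n + 1) → ℂ}
    (hb : b ∈ confSet Ω n) (h₁ : RatioConn Ω a b) (h₂ : RatioConn Ω b c) : RatioConn Ω a c := by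
  obtain ⟨r₁, hr₁, ht₁⟩ := h₁
  obtain ⟨r₂, hr₂, ht₂⟩ := h₂
  refine ⟨r₂ * r₁, mul_pos hr₂ hr₁, (ht₂.mul ht₁).congr' ?_⟩
  filter_upwards [eventually_forall_meshIsingPlusCorr_pos hM hN (isCompact_singleton_conf b)
    (singleton_subset_iff.2 hb)] with δ hδ
  rw [div_mul_div_cancel₀ (hδ b (mem_singleton b)).ne']

/-- **A straight move joins** (CHI §2.8): `tendsto_ratio_moveConf`.
[cite: ChelkakHonglerIzyurovAnnals2015, §2.8, proof of Prop. 2.20] -/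
theorem ratioConn_moveConf (hΩ : IsAdmissibleDomain Ω) (hM : MeshApproximates Ω)
    (h𝒜 : ∀ (n : ℕ) (j : Fin (n + 1)), ContinuousOn (𝒜 n j) (confSet Ω n))
    (hD : CHILogDerivative Ω 𝒜) (hN : CHINeighbourRatio Ω)
    {a : Fin (n + 1) → ℂ} {j : Fin (n + 1)} {u : ℂ} (hu : u ∈ diagSteps) {t : ℝ} (ht : 0 ≤ t)
    (hseg : ∀ s ∈ Icc (0 : ℝ) t, moveConf a j u s ∈ confSet Ω n) : RatioConn Ω a (moveConf a j u t) :=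
  ⟨_, Real.exp_pos _, tendsto_ratio_moveConf hΩ hM h𝒜 hD hN hu ht hseg⟩

/-- **A diagonal stair step of one marked point joins.** If `x ↦ (d with d_j = x)` maps `U` into the
configuration space and `z, w ∈ U` are joined by one stair step in `U` with the diagonal directions
`1 ± i`, the two configurations are joined by a ratio limit.
[cite: ChelkakHonglerIzyurovAnnals2015, §2.8, proof of Prop. 2.20] -/
theorem ratioConn_update_of_stairStep (hΩ : IsAdmissibleDomain Ω) (hM : MeshApproximates Ω)
    (h𝒜 : ∀ (n : ℕ) (j : Fin (n + 1)), ContinuousOn (𝒜 n j) (confSet Ω n))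
    (hD : CHILogDerivative Ω 𝒜) (hN : CHINeighbourRatio Ω)
    (d : Fin (n + 1) → ℂ) (j : Fin (n + 1)) {U : Set ℂ}
    (hU : ∀ x ∈ U, Function.update d j x ∈ confSet Ω n) {z w : ℂ}
    (h : StairStep U (1 + I) (1 - I) z w) :
    RatioConn Ω (Function.update d j z) (Function.update d j w) := by
  obtain ⟨hsegU, t, ht⟩ := h
  -- the direction `v` and the displacement `w = z + t v`
  obtain ⟨v, hv, hw⟩ : ∃ v ∈ diagSteps, w = z + t * v := by
    rcases ht with ht | ht
    · exact ⟨1 + I, by simp [diagSteps], ht⟩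
    · exact ⟨1 - I, by simp [diagSteps], ht⟩
  -- orient so that the time is nonnegative
  obtain ⟨u, hu, s₀, hs₀, hw'⟩ : ∃ u ∈ diagSteps, ∃ s₀ : ℝ, 0 ≤ s₀ ∧ w = z + s₀ * u := by
    rcases le_or_gt 0 t with ht0 | ht0
    · exact ⟨v, hv, t, ht0, hw⟩
    · refine ⟨-v, neg_mem_diagSteps hv, -t, by linarith, ?_⟩
      rw [hw]; push_cast; ring
  -- the move of the configuration `update d j z`
  have hmove : ∀ s : ℝ, moveConf (Function.update d j z) j u s = Function.update d j (z + s * u) := by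
    intro s
    unfold moveConf
    rw [Function.update_idem, Function.update_self]
  have hsegconf : ∀ s ∈ Icc (0 : ℝ) s₀, moveConf (Function.update d j z) j u s ∈ confSet Ω n := by
    intro s hs
    rw [hmove]
    refine hU _ (hsegU ?_)
    -- `z + s u ∈ [z, w]`
    rw [segment_eq_image']
    rcases eq_or_lt_of_le hs₀ with h0 | h0
    · refine ⟨0, ⟨le_rfl, zero_le_one⟩, ?_⟩
      have : s = 0 := le_antisymm (h0 ▸ hs.2) hs.1
      simp [this]
    · refine ⟨s / s₀, ⟨div_nonneg hs.1 hs₀, (div_le_one h0).2 hs.2⟩, ?_⟩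
      show z + (s / s₀) • (w - z) = z + (s : ℂ) * u
      have hs₀' : (s₀ : ℂ) ≠ 0 := by exact_mod_cast h0.ne'
      rw [hw', Complex.real_smul]
      push_cast
      field_simp
      ring
  have hconn := ratioConn_moveConf hΩ hM h𝒜 hD hN hu hs₀ hsegconf
  rwa [hmove s₀, ← hw'] at hconn

/-- **Configurations avoiding a finite set**: an open nonempty `Ω` contains `n+1` distinct points outside
any finite set. [folklore] -/
theorem exists_conf_avoiding (hΩo : IsOpen Ω) (hne : Ω.Nonempty) {T : Set ℂ} (hT : T.Finite) (n : ℕ) :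
    ∃ c ∈ confSet Ω n, ∀ i, c i ∉ T := by
  have hinf : (Ω \ T).Infinite :=
    (Literature.Topology.Euclidean.infinite_of_isOpen hΩo hne).sdiff hT
  set e := hinf.natEmbedding
  refine ⟨fun i => (e i : ℂ), ⟨fun i i' h => ?_, fun i => (e i).2.1⟩, fun i => (e i).2.2⟩
  exact Fin.val_injective (e.injective (Subtype.ext h))

/-- Replacing the first `k` marked points of `a` by those of `c`. [folklore] -/
def mixConf (c a : Fin (n + 1) → ℂ) (k : ℕ) : Fin (n + 1) → ℂ :=
  fun i => if (i : ℕ) < k then c i else a i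

/-- No point replaced. [folklore] -/
theorem mixConf_zero (c a : Fin (n + 1) → ℂ) : mixConf c a 0 = a := by
  funext i; simp [mixConf]

/-- All points replaced. [folklore] -/
theorem mixConf_all (c a : Fin (n + 1) → ℂ) : mixConf c a (n + 1) = c := by
  funext i; simp [mixConf, i.2]

/-- One more point replaced. [folklore] -/
theorem mixConf_succ (c a : Fin (n + 1) → ℂ) {k : ℕ} (hk : k < n + 1) :
    mixConf c a (k + 1) = Function.update (mixConf c a k) ⟨k, hk⟩ (c ⟨k, hk⟩) := by
  funext i
  by_cases hi : i = ⟨k, hk⟩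
  · subst hi
    simp [mixConf]
  · have hik : (i : ℕ) ≠ k := fun h => hi (Fin.ext h)
    rw [Function.update_of_ne hi]
    simp only [mixConf]
    by_cases h1 : (i : ℕ) < k
    · simp [h1, Nat.lt_succ_of_lt h1]
    · have h2 : ¬(i : ℕ) < k + 1 := by omega
      simp [h1, h2]

/-- The unreplaced point `k`. [folklore] -/
theorem mixConf_apply_self (c a : Fin (n + 1) → ℂ) {k : ℕ} (hk : k < n + 1) :
    mixConf c a k ⟨k, hk⟩ = a ⟨k, hk⟩ := by
  simp [mixConf]

/-- Mixed configurations of two configurations with disjoint ranges are configurations. [folklore] -/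
theorem mixConf_mem_confSet {c a : Fin (n + 1) → ℂ} (hc : c ∈ confSet Ω n) (ha : a ∈ confSet Ω n)
    (hdis : ∀ i i', c i ≠ a i') (k : ℕ) : mixConf c a k ∈ confSet Ω n := by
  refine ⟨fun i i' h => ?_, fun i => ?_⟩
  · simp only [mixConf] at h
    by_cases hi : (i : ℕ) < k <;> by_cases hi' : (i' : ℕ) < k <;> simp only [hi, hi', if_true, if_false] at h
    · exact hc.1 h
    · exact absurd h (hdis i i')
    · exact absurd h.symm (hdis i' i)
    · exact ha.1 h
  · simp only [mixConf]
    split_ifs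
    · exact hc.2 i
    · exact ha.2 i

/-- **Induction on the configuration space along coordinate-wise diagonal staircases** (CHI §2.8:
"`γ` is any path in `Ω̃^{k+1}` … consisting of segments with all but one coordinates fixed"): a
reflexive, symmetric and transitive relation on the configurations of an admissible `Ω` that holds
across every diagonal stair step of a single marked point (inside the configuration space) holds between
any two configurations. The points of `a` are moved one at a time, through a configuration with
disjoint range, along diagonal staircases avoiding the other points
(`Literature.Topology.Euclidean.staircase_diff_finite`). [cite: ChelkakHonglerIzyurovAnnals2015, §2.8, proof of Prop. 2.20] -/
theorem confSet_pair_induction (hΩ : IsAdmissibleDomain Ω)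
    {R : (Fin (n + 1) → ℂ) → (Fin (n + 1) → ℂ) → Prop}
    (hrefl : ∀ a ∈ confSet Ω n, R a a) (hsymm : ∀ a b, R a b → R b a)
    (htrans : ∀ a b c, b ∈ confSet Ω n → R a b → R b c → R a c)
    (hstep : ∀ (d : Fin (n + 1) → ℂ) (j : Fin (n + 1)) (U : Set ℂ),
      (∀ x ∈ U, Function.update d j x ∈ confSet Ω n) →
        ∀ z w : ℂ, StairStep U (1 + I) (1 - I) z w → R (Function.update d j z) (Function.update d j w))
    {a b : Fin (n + 1) → ℂ} (ha : a ∈ confSet Ω n) (hb : b ∈ confSet Ω n) : R a b := by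
  have hΩo : IsOpen Ω := hΩ.1
  have hΩc : IsPreconnected Ω := hΩ.2.2.2.isPathConnected.isConnected.isPreconnected
  -- staircases of one marked point
  have hstair : ∀ (d : Fin (n + 1) → ℂ) (j : Fin (n + 1)) (U : Set ℂ),
      (∀ x ∈ U, Function.update d j x ∈ confSet Ω n) → ∀ z w : ℂ, z ∈ U →
        Staircase U (1 + I) (1 - I) z w → R (Function.update d j z) (Function.update d j w) := by
    intro d j U hU z w hz h
    induction h with
    | refl => exact hrefl _ (hU z hz)
    | tail hzb hbc ih =>
      exact htrans _ _ _ (hU _ (Staircase.right_mem hzb hz)) ih (hstep d j U hU _ _ hbc)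
  -- coordinate-by-coordinate replacement towards a configuration with disjoint range
  have hmix : ∀ {c a : Fin (n + 1) → ℂ}, c ∈ confSet Ω n → a ∈ confSet Ω n → (∀ i i', c i ≠ a i') →
      ∀ k ≤ n + 1, R a (mixConf c a k) := by
    intro c a hc ha hdis k
    induction k with
    | zero => intro _; rw [mixConf_zero]; exact hrefl a ha
    | succ k ih =>
      intro hk
      have hk' : k < n + 1 := Nat.lt_of_succ_le hk
      have h1 := ih hk'.le
      rw [mixConf_succ c a hk']
      set d := mixConf c a k with hd
      set j : Fin (n + 1) := ⟨k, hk'⟩ with hj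
      have hdconf : d ∈ confSet Ω n := mixConf_mem_confSet hc ha hdis k
      set F : Set ℂ := (fun i => d i) '' {i | i ≠ j} with hF
      have hFfin : F.Finite := (Set.toFinite _).image _
      have hU : ∀ x ∈ Ω \ F, Function.update d j x ∈ confSet Ω n := by
        intro x hx
        refine ⟨fun i i' h => ?_, fun i => ?_⟩
        · by_cases hi : i = j <;> by_cases hi' : i' = j
          · rw [hi, hi']
          · subst hi
            rw [Function.update_self, Function.update_of_ne hi'] at h
            exact absurd ⟨i', hi', h.symm⟩ hx.2
          · subst hi'
            rw [Function.update_self, Function.update_of_ne hi] at h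
            exact absurd ⟨i, hi, h⟩ hx.2
          · rw [Function.update_of_ne hi, Function.update_of_ne hi'] at h
            exact hdconf.1 h
        · by_cases hi : i = j
          · subst hi; rw [Function.update_self]; exact hx.1
          · rw [Function.update_of_ne hi]; exact hdconf.2 i
      have hdj : d j = a j := mixConf_apply_self c a hk'
      have haj : a j ∈ Ω \ F := by
        refine ⟨ha.2 j, ?_⟩
        rintro ⟨i, hi, h⟩
        simp only [hd, mixConf] at h
        split_ifs at h with h2
        · exact hdis i j h
        · exact hi (ha.1 h)
      have hcj : c j ∈ Ω \ F := by
        refine ⟨hc.2 j, ?_⟩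
        rintro ⟨i, hi, h⟩
        simp only [hd, mixConf] at h
        split_ifs at h with h2
        · exact hi (hc.1 h)
        · exact hdis j i h.symm
      have hst : Staircase (Ω \ F) (1 + I) (1 - I) (a j) (c j) :=
        staircase_diff_finite hΩo hΩc hFfin cross_diag_ne_zero haj hcj
      have h2 := hstair d j _ hU _ _ haj hst
      rw [← hdj, Function.update_eq_self] at h2
      exact htrans _ _ _ hdconf h1 h2
  -- through a configuration avoiding both ranges
  obtain ⟨c, hc, hcT⟩ := exists_conf_avoiding hΩo hΩ.2.2.1
    ((Set.finite_range a).union (Set.finite_range b)) n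
  have hca : ∀ i i', c i ≠ a i' := fun i i' h => hcT i (Or.inl ⟨i', h.symm⟩)
  have hcb : ∀ i i', c i ≠ b i' := fun i i' h => hcT i (Or.inr ⟨i', h.symm⟩)
  have h1 : R a c := by
    have := hmix hc ha hca (n + 1) le_rfl
    rwa [mixConf_all] at this
  have h2 : R b c := by
    have := hmix hc hb hcb (n + 1) le_rfl
    rwa [mixConf_all] at this
  exact htrans _ _ _ hc h1 (hsymm _ _ h2)

/-- **Any two configurations are joined by a ratio limit.** [cite: ChelkakHonglerIzyurovAnnals2015, Prop. 2.20] -/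
theorem ratioConn_of_mem_confSet (hΩ : IsAdmissibleDomain Ω) (hM : MeshApproximates Ω)
    (h𝒜 : ∀ (n : ℕ) (j : Fin (n + 1)), ContinuousOn (𝒜 n j) (confSet Ω n))
    (hD : CHILogDerivative Ω 𝒜) (hN : CHINeighbourRatio Ω)
    {a b : Fin (n + 1) → ℂ} (ha : a ∈ confSet Ω n) (hb : b ∈ confSet Ω n) : RatioConn Ω a b :=
  confSet_pair_induction hΩ (R := RatioConn Ω) (fun _ ha => RatioConn.refl hM hN ha)
    (fun _ _ h => h.symm) (fun _ _ _ hb h₁ h₂ => RatioConn.trans hM hN hb h₁ h₂)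
    (fun d j _ hU _ _ h => ratioConn_update_of_stairStep hΩ hM h𝒜 hD hN d j hU h) ha hb

/-- **CHI Proposition 2.20 (existence and positivity of the ratio limits) from CHI Theorem 1.5 and
Remark 2.18.** For an admissible `Ω` with `MeshApproximates Ω`, if the discrete logarithmic derivatives of
`𝔼⁺_{Ω_δ}[σ_{a_0}⋯σ_{a_n}]` with respect to each `a_j` converge uniformly on compact sets of
configurations to `Re(𝒜_j u)` with `𝒜_j` continuous (`CHILogDerivative`, CHI Thm 1.5) and the ratios at
adjacent faces tend to `1` (`CHINeighbourRatio`, CHI Remark 2.18), then for any two `(n+1)`-tuples of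
distinct points of `Ω` the ratio `𝔼⁺_{Ω_δ}[σ_{b_0}⋯σ_{b_n}] / 𝔼⁺_{Ω_δ}[σ_{a_0}⋯σ_{a_n}]` has a positive
limit — the tree's hypothesis predicate `CHIRatioLimits Ω` of `PlanarIsingMultiPointLimits.lean`.
[cite: ChelkakHonglerIzyurovAnnals2015, Prop. 2.20 (from Thm. 1.5, §2.8)] -/
theorem chiRatioLimits_of_logDerivative (hΩ : IsAdmissibleDomain Ω) (hM : MeshApproximates Ω)
    (h𝒜 : ∀ (n : ℕ) (j : Fin (n + 1)), ContinuousOn (𝒜 n j) (confSet Ω n))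
    (hD : CHILogDerivative Ω 𝒜) (hN : CHINeighbourRatio Ω) : CHIRatioLimits Ω :=
  fun _ _ _ ha hb haΩ hbΩ =>
    ratioConn_of_mem_confSet hΩ hM h𝒜 hD hN ⟨ha, haΩ⟩ ⟨hb, hbΩ⟩

end Assembly

end Literature.Probability.LatticeModels
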